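import Mathlib
import Literature.Probability.Percolation.DiagonalStripReflectedRoots
import Literature.Probability.Percolation.DiagonalStripSumNonvanishing
import HarnessLib

/-!
# IP12 (27) up to a `z_1`-free factor: pinning the recursion scalar from the wheel roots

Topic `Literature/Probability/Percolation`. Ikhlef–Ponsaing (J. Stat. Phys. 149 (2012),
arXiv:1202.5476) (25)/(27): `Z_L(z_{i+1} = q z_i) = Z_{L-2}(ẑ) · (-1)^L ∏_{ℓ ∉ {i,i+1}} k(z_i, z_ℓ)` with
`k(a,b) = [q b/a][q/(a b)]`; in IP12 the scalar comes from the explicit nested component of §3.5. Here,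
for the exact primitive ground state of this development and WITHOUT explicit components, we prove
the `z_1`-structure of `Z|_{z_2 = q z_1} = η_1(Σ_Q P_Q)` conditionally on the joint degree bound
`deg_{X_1} η_1(Σ P) ≤ 4(L-2)` (the (DEG) input of the development, needed here only for the sum):

* `hypSubst_sum_ne_zero` — `η_1(Σ P) ≠ 0` (else `X_2 - q X_1` would divide every component, by the
  recursion up to scalar and `Σ P'' ≠ 0`);
* `substHom_neg_comp_hypSubst`, `hypSubst_sum_parity`, `eval_neg_rapUni`, `eval_neg_rapUni_eq_zero` —
  parity in `X_1`, so the roots come in pairs `± x`;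
* `wheelRoot_injOn` — the `4(L-2)` roots `± q z_j^{±1}`, `3 ≤ j ≤ L`, are pairwise distinct;
* `prod_wheelRoot_bool` — the four roots at `j` multiply to `(z² - q² z_j²)(z² - q² z_j⁻²)`;
* **`hypSubst_sum_eq_prod_wheel`** — `toRF (η_1(Σ P)) = toRF c · ∏_{j=3}^{L} (z_1² - q² z_j²)(z_1² - q² z_j⁻²)`
  with `deg_{X_1} c = 0`, i.e. the recursion scalar restricted to the sum is `∏_{j ≥ 3} k(z_1, z_j)`
  up to a factor free of `z_1` (Euclid in `(RapidityField ℂ)[T]` via `RapidityUnivariate`).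

## References

* Y. Ikhlef, A. K. Ponsaing, *Finite-size left-passage probability in percolation*, J. Stat. Phys.
  149 (2012) 10–36, arXiv:1202.5476, §3.4 (25), §3.6 (27) and proof of Prop. 3.4. [IkhlefPonsaing2012]
-/

namespace Literature.Probability.Percolation

open Finset Literature.Probability.LatticeModels Literature.Probability.LatticeModels.TemperleyLieb

/-! ### The restricted sum `η_1(Z)` is not zero -/

section RestrictedSum

open MvPolynomial

variable {n : ℕ}

/-- **`η_1(Σ_Q P_Q) ≠ 0` for the primitive ground state** (otherwise, by the recursion up to scalar,
every `η_1(P_k)` would vanish and `X_2 - q X_1` would divide all components).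
[cite: IkhlefPonsaing2012, (25), Prop. 3.4] -/
theorem hypSubst_sum_ne_zero {q : ℂ} (hq : q ^ 2 + q + 1 = 0) {P : ColPattern (n + 1) → MvPolynomial ℕ ℂ}
    (hprim : PolyPrimitive P)
    (hP : ∀ Q', ∑ Q, ipTransferMatrixW (n + 1) (genC ℂ q) (genW ℂ) (genZ ℂ) Q Q' * toRF ℂ (P Q) = toRF ℂ (P Q')) :
    hypSubst q 1 (∑ Q, P Q) ≠ 0 := by
  classical
  obtain ⟨P'', hprim'', hP''⟩ := exists_ipTransferMatrixW_fixed_primitive (m := n) hq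
  have hP''0 : P'' ≠ 0 := by
    obtain ⟨R₀, hR₀⟩ := hprim''.exists_ne_zero
    intro h; exact hR₀ (congrFun h R₀)
  set Φ₁ : ColPattern (n + 1) → MvPolynomial ℕ ℂ := fun Q =>
    ∑ R ∈ Finset.univ.filter (fun R => cpInsDup 0 R = Q), hatRename 1 (P'' R) with hΦ₁
  have I1 : ∀ k Q, Φ₁ k * hypSubst q 1 (P Q) = hypSubst q 1 (P k) * Φ₁ Q := by
    intro k Q
    have h := congrFun (groundState_hyp_recursion_odd hq (0 : Fin (n + 1)) hP hP'' k) Q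
    simp only [Fin.val_zero, mul_zero, zero_add, Pi.smul_apply, smul_eq_mul] at h
    apply toRF_injective
    rw [map_mul, map_mul, hΦ₁]; simp only [map_sum]
    exact h
  have Isum : ∀ k, Φ₁ k * hypSubst q 1 (∑ Q, P Q) = hypSubst q 1 (P k) * hatRename 1 (∑ R, P'' R) := by
    intro k
    rw [map_sum, Finset.mul_sum, Finset.sum_congr rfl fun Q _ => I1 k Q, ← Finset.mul_sum, map_sum]
    congr 1
    exact sum_fiber_total (fun R => cpInsDup 0 R) fun R => hatRename 1 (P'' R)
  have hZ'' : hatRename 1 (∑ R, P'' R) ≠ 0 := fun h =>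
    groundState_sum_ne_zero hq hP''0 hP'' (hatRename_injective 1 (h.trans (map_zero _).symm))
  intro hF
  -- every `η_1(P_k)` vanishes, so `X_2 - q X_1` divides every component
  have hall : ∀ k, (X 2 - C q * X 1 : MvPolynomial ℕ ℂ) ∣ P k := by
    intro k
    have h := Isum k
    rw [hF, mul_zero] at h
    have h0 : hypSubst q 1 (P k) = 0 := (mul_eq_zero.1 h.symm).resolve_right hZ''
    refine X_sub_dvd_of_substHom_eq_zero ?_
    rw [show (2 : ℕ) = 1 + 1 from rfl, substHom_eq_hypSubst]; exact h0
  exact hprim.not_forall_dvd (not_isUnit_X_sub 2 1 (by omega) q) hall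

end RestrictedSum

/-! ### Parity of `η_1(Z)` in `X_1` -/

section Parity

open MvPolynomial

variable {n : ℕ}

/-- `flip_1 ∘ η_1 = η_1 ∘ flip_1 ∘ flip_2`. [folklore] -/
theorem substHom_neg_comp_hypSubst (q : ℂ) :
    (substHom 1 (-X 1)).toRingHom.comp (hypSubst q 1) =
      (hypSubst q 1).comp ((substHom 1 (-X 1)).toRingHom.comp (substHom (K₀ := ℂ) 2 (-X 2)).toRingHom) := by
  refine ringHom_ext (fun a => ?_) (fun k => ?_)
  · simp only [RingHom.comp_apply, AlgHom.toRingHom_eq_coe, RingHom.coe_coe, hypSubst_C, substHom_C]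
  · simp only [RingHom.comp_apply, AlgHom.toRingHom_eq_coe, RingHom.coe_coe]
    by_cases hk1 : k = 1
    · subst hk1
      rw [hypSubst_X_of_ne q (by omega), substHom_X_self, substHom_X_of_ne _ (by omega), substHom_X_self, map_neg,
        hypSubst_X_of_ne q (by omega)]
    by_cases hk2 : k = 2
    · subst hk2
      rw [show (2 : ℕ) = 1 + 1 from rfl, hypSubst_X_self, map_mul, substHom_C, substHom_X_self, substHom_X_self,
        map_neg, substHom_X_of_ne _ (by omega), map_neg, hypSubst_X_self, mul_neg]
    · rw [hypSubst_X_of_ne q (show k ≠ 1 + 1 by omega), substHom_X_of_ne _ hk1, substHom_X_of_ne _ hk2,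
        substHom_X_of_ne _ hk1, hypSubst_X_of_ne q (show k ≠ 1 + 1 by omega)]

/-- **`η_1(Σ P)` has a parity in `X_1`** for the primitive ground state. [folklore] -/
theorem hypSubst_sum_parity {q : ℂ} (hq : q ^ 2 + q + 1 = 0) {P : ColPattern (n + 1) → MvPolynomial ℕ ℂ}
    (hprim : PolyPrimitive P)
    (hP : ∀ Q', ∑ Q, ipTransferMatrixW (n + 1) (genC ℂ q) (genW ℂ) (genZ ℂ) Q Q' * toRF ℂ (P Q) = toRF ℂ (P Q')) :
    ∃ ε : ℂ, ε ^ 2 = 1 ∧ substHom 1 (-X 1) (hypSubst q 1 (∑ Q, P Q)) = C ε * hypSubst q 1 (∑ Q, P Q) := by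
  obtain ⟨ε₁, hε₁, h₁⟩ := primitive_fixed_parity hq hprim hP 1
  obtain ⟨ε₂, hε₂, h₂⟩ := primitive_fixed_parity hq hprim hP 2
  refine ⟨ε₁ * ε₂, by rw [mul_pow, hε₁, hε₂, one_mul], ?_⟩
  have e := RingHom.congr_fun (substHom_neg_comp_hypSubst q) (∑ Q, P Q)
  simp only [RingHom.comp_apply, AlgHom.toRingHom_eq_coe, RingHom.coe_coe] at e
  rw [e, map_sum (substHom 2 (-X 2)), Finset.sum_congr rfl fun Q _ => h₂ Q, ← Finset.mul_sum, map_mul, substHom_C,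
    map_sum (substHom 1 (-X 1)), Finset.sum_congr rfl fun Q _ => h₁ Q, ← Finset.mul_sum, ← mul_assoc, ← map_mul,
    map_mul, hypSubst_C, mul_comm ε₂ ε₁]

/-- Evaluating `rapUni 1 G` at `-x` is evaluating `rapUni 1 (flip_1 G)` at `x`. [folklore] -/
theorem eval_neg_rapUni (x : RapidityField ℂ) (G : MvPolynomial ℕ ℂ) :
    (rapUni ℂ 1 G).eval (-x) = (rapUni ℂ 1 (substHom 1 (-X 1) G)).eval x := by
  rw [eval_rapUni, eval_rapUni]
  have : eval₂Hom ((toRF ℂ).comp C) (Function.update (genZ ℂ) 1 (-x)) =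
      (eval₂Hom ((toRF ℂ).comp C) (Function.update (genZ ℂ) 1 x)).comp (substHom 1 (-X 1)).toRingHom := by
    refine ringHom_ext (fun a => ?_) (fun k => ?_)
    · simp only [RingHom.comp_apply, AlgHom.toRingHom_eq_coe, RingHom.coe_coe, substHom_C, eval₂Hom_C]
    · simp only [RingHom.comp_apply, AlgHom.toRingHom_eq_coe, RingHom.coe_coe, eval₂Hom_X']
      by_cases hk : k = 1
      · subst hk; rw [substHom_X_self, map_neg, eval₂Hom_X', Function.update_self, Function.update_self]
      · rw [substHom_X_of_ne _ hk, eval₂Hom_X', Function.update_of_ne hk, Function.update_of_ne hk]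
  rw [this, RingHom.comp_apply]; rfl

/-- Roots of an `X_1`-even/odd polynomial come in pairs `±x`. [folklore] -/
theorem eval_neg_rapUni_eq_zero {G : MvPolynomial ℕ ℂ} {ε : ℂ} (hG : substHom 1 (-X 1) G = C ε * G)
    {x : RapidityField ℂ} (hx : (rapUni ℂ 1 G).eval x = 0) : (rapUni ℂ 1 G).eval (-x) = 0 := by
  rw [eval_neg_rapUni, hG, map_mul, rapUni_C, Polynomial.eval_mul, Polynomial.eval_C, hx, mul_zero]

end Parity

/-! ### The `8m - 4` wheel roots are distinct -/

section Distinct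

open MvPolynomial

/-- **The wheel roots `± q z_j^{±1}` are pairwise distinct.** (Clearing `z_j z_{j'}` turns an equality of
two of them into an equality of monomials.) [folklore] -/
theorem wheelRoot_injOn {q : ℂ} (hq0 : q ≠ 0) (J : Finset ℕ) :
    Set.InjOn (fun i : ℕ × Bool × Bool => genC ℂ (if i.2.1 then q else -q) *
        (if i.2.2 then genZ ℂ i.1 else (genZ ℂ i.1)⁻¹))
      ((J ×ˢ ((Finset.univ : Finset Bool) ×ˢ (Finset.univ : Finset Bool)) : Finset (ℕ × Bool × Bool)) : Set _) := by
  classical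
  rintro ⟨j, s, b⟩ - ⟨j', s', b'⟩ - h
  simp only at h
  have hz := genZ_ne_zero (K₀ := ℂ) j
  have hz' := genZ_ne_zero (K₀ := ℂ) j'
  -- exponent vectors after clearing `z_j z_{j'}`
  set m : ℕ →₀ ℕ := if b then Finsupp.single j 2 + Finsupp.single j' 1 else Finsupp.single j' 1 with hm
  set m' : ℕ →₀ ℕ := if b' then Finsupp.single j' 2 + Finsupp.single j 1 else Finsupp.single j 1 with hm'
  have hmon : ∀ a c : ℕ, (monomial (Finsupp.single a 2 + Finsupp.single c 1)) (1 : ℂ) = X a ^ 2 * X c := by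
    intro a c; rw [X_pow_eq_monomial, X, monomial_mul, mul_one]
  have e1 : (if b then genZ ℂ j else (genZ ℂ j)⁻¹) * (genZ ℂ j * genZ ℂ j') = toRF ℂ (monomial m 1) := by
    rw [hm]
    cases b
    · simp only [Bool.false_eq_true, ↓reduceIte]
      rw [← mul_assoc, inv_mul_cancel₀ hz, one_mul, ← X_pow_eq_monomial, pow_one]; rfl
    · simp only [↓reduceIte]
      rw [hmon, map_mul, map_pow]
      unfold genZ; ring
  have e2 : (if b' then genZ ℂ j' else (genZ ℂ j')⁻¹) * (genZ ℂ j * genZ ℂ j') = toRF ℂ (monomial m' 1) := by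
    rw [hm']
    cases b'
    · simp only [Bool.false_eq_true, ↓reduceIte]
      rw [mul_comm (genZ ℂ j), ← mul_assoc, inv_mul_cancel₀ hz', one_mul, ← X_pow_eq_monomial, pow_one]; rfl
    · simp only [↓reduceIte]
      rw [hmon, map_mul, map_pow]
      unfold genZ; ring
  have h2 : genC ℂ (if s then q else -q) * (if b then genZ ℂ j else (genZ ℂ j)⁻¹) * (genZ ℂ j * genZ ℂ j') =
      genC ℂ (if s' then q else -q) * (if b' then genZ ℂ j' else (genZ ℂ j')⁻¹) * (genZ ℂ j * genZ ℂ j') := by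
    rw [h]
  rw [mul_assoc, mul_assoc, e1, e2, show genC ℂ (if s then q else -q) = toRF ℂ (C (if s then q else -q)) from rfl,
    show genC ℂ (if s' then q else -q) = toRF ℂ (C (if s' then q else -q)) from rfl, ← map_mul, ← map_mul,
    C_mul_monomial, C_mul_monomial, mul_one, mul_one] at h2
  have h3 := toRF_injective h2
  rw [monomial_eq_monomial_iff] at h3
  have hcs : (if s then q else -q) ≠ 0 := by split_ifs <;> simp [hq0]
  rcases h3 with ⟨hmm, hcc⟩ | ⟨h0, -⟩
  swap; · exact absurd h0 hcs
  -- signs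
  have hs : s = s' := by
    cases s <;> cases s' <;> simp at hcc ⊢
    · have : q = 0 := by linear_combination -hcc / 2
      exact hq0 this
    · have : q = 0 := by linear_combination hcc / 2
      exact hq0 this
  -- exponents
  have kj := congrArg (fun f : ℕ →₀ ℕ => f j) hmm
  have kj' := congrArg (fun f : ℕ →₀ ℕ => f j') hmm
  simp only [hm, hm'] at kj kj'
  by_cases hjj : j = j'
  · subst hjj
    cases b <;> cases b' <;> simp at kj <;> first | rfl | (subst hs; rfl)
  · cases b <;> cases b' <;> simp [hjj] at kj kj'

end Distinct

/-! ### Pinning the `z_1`-dependence of `η_1(Z)` under the joint degree bound -/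

section Pinning

open MvPolynomial

variable {n : ℕ}

/-- `genC (-q) = - genC q`. [folklore] -/
theorem genC_neg (q : ℂ) : genC ℂ (-q) = -genC ℂ q := by
  unfold genC; rw [map_neg, map_neg]

/-- The four wheel roots at `j` multiply to `(z² - q² z_j²)(z² - q² z_j⁻²)`. [folklore] -/
theorem prod_wheelRoot_bool (q : ℂ) (j : ℕ) (z : RapidityField ℂ) :
    ∏ sb ∈ ((Finset.univ : Finset Bool) ×ˢ (Finset.univ : Finset Bool)),
        (z - genC ℂ (if sb.1 then q else -q) * (if sb.2 then genZ ℂ j else (genZ ℂ j)⁻¹)) =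
      (z ^ 2 - genC ℂ q ^ 2 * genZ ℂ j ^ 2) * (z ^ 2 - genC ℂ q ^ 2 * (genZ ℂ j)⁻¹ ^ 2) := by
  rw [Finset.prod_product]
  simp only [Fintype.prod_bool, ↓reduceIte, Bool.false_eq_true, genC_neg]
  ring

/-- **IP12 (27) up to a `z_1`-free factor, without explicit components**: under the joint degree
bound `deg_{X_1} η_1(Σ_Q P_Q) ≤ 4(L-2)` (the (DEG) input, here only for the SUM on the hyperplane),
`η_1(Z) = c · ∏_{j=3}^{L} (z_1² - q² z_j²)(z_1² - q² z_j⁻²)` with `c` free of `z_1` — i.e. the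
recursion scalar of (25) restricted to the sum is `∏_{j ≥ 3} k(z_1, z_j)` up to a factor not
involving `z_1`. [cite: IkhlefPonsaing2012, (25), (27), Prop. 3.4] -/
theorem hypSubst_sum_eq_prod_wheel {q : ℂ} (hq : q ^ 2 + q + 1 = 0)
    {P : ColPattern (n + 1) → MvPolynomial ℕ ℂ} (hprim : PolyPrimitive P)
    (hP : ∀ Q', ∑ Q, ipTransferMatrixW (n + 1) (genC ℂ q) (genW ℂ) (genZ ℂ) Q Q' * toRF ℂ (P Q) = toRF ℂ (P Q'))
    {a' : ℤ} (hbot : ∀ Q, genInv ℂ 1 (toRF ℂ (P Q)) = genZ ℂ 1 ^ (2 * a') * toRF ℂ (P Q))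
    (hsym : ∀ a b : ℕ, 1 ≤ a → a ≤ b → b ≤ 2 * (n + 1) + 1 → rename (Equiv.swap a b) (∑ Q, P Q) = ∑ Q, P Q)
    (hdeg : (hypSubst q 1 (∑ Q, P Q)).degreeOf 1 ≤ 4 * (2 * n + 1)) :
    ∃ c : MvPolynomial ℕ ℂ, c.degreeOf 1 = 0 ∧
      toRF ℂ (hypSubst q 1 (∑ Q, P Q)) = toRF ℂ c *
        ∏ j ∈ Finset.Icc 3 (2 * (n + 1) + 1),
          ((genZ ℂ 1 ^ 2 - genC ℂ q ^ 2 * genZ ℂ j ^ 2) * (genZ ℂ 1 ^ 2 - genC ℂ q ^ 2 * (genZ ℂ j)⁻¹ ^ 2)) := by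
  classical
  have hq0 : q ≠ 0 := q_ne_zero_of_quad hq
  set F := hypSubst q 1 (∑ Q, P Q) with hF
  set p := rapUni ℂ 1 F with hp
  set J := Finset.Icc 3 (2 * (n + 1) + 1) with hJ
  set t : Finset (ℕ × Bool × Bool) := J ×ˢ ((Finset.univ : Finset Bool) ×ˢ (Finset.univ : Finset Bool)) with ht
  set root : ℕ × Bool × Bool → RapidityField ℂ := fun i =>
    genC ℂ (if i.2.1 then q else -q) * (if i.2.2 then genZ ℂ i.1 else (genZ ℂ i.1)⁻¹) with hroot
  -- all the roots
  obtain ⟨ε, -, hpar⟩ := hypSubst_sum_parity hq hprim hP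
  have hroots : ∀ i ∈ t, p.eval (root i) = 0 := by
    rintro ⟨j, s, b⟩ hi
    rw [ht, Finset.mem_product, hJ, Finset.mem_Icc] at hi
    obtain ⟨⟨hj3, hjL⟩, -⟩ := hi
    have hw := sum_wheel_roots hq hP hbot hsym hj3 hjL
    have base : p.eval (genC ℂ q * (if b then genZ ℂ j else (genZ ℂ j)⁻¹)) = 0 := by
      cases b
      · exact hw.2
      · exact hw.1
    cases s
    · have e : root (j, false, b) = -(genC ℂ q * (if b then genZ ℂ j else (genZ ℂ j)⁻¹)) := by
        simp only [hroot, Bool.false_eq_true, ↓reduceIte, genC_neg, neg_mul]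
      rw [e]
      exact eval_neg_rapUni_eq_zero hpar base
    · simpa only [hroot, ↓reduceIte] using base
  -- the product of the linear factors divides `p`
  set D : Polynomial (RapidityField ℂ) := ∏ i ∈ t, (Polynomial.X - Polynomial.C (root i)) with hD
  have hdvd : D ∣ p := by
    refine Finset.prod_dvd_of_coprime (fun i hi i' hi' hii' => ?_) (fun i hi => ?_)
    · exact Polynomial.isCoprime_X_sub_C_of_isUnit_sub
        (sub_ne_zero.2 (fun h => hii' (wheelRoot_injOn hq0 J hi hi' h))).isUnit
    · exact Polynomial.dvd_iff_isRoot.2 (hroots i hi)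
  have hDmonic : D.Monic := Polynomial.monic_prod_of_monic _ _ fun i _ => Polynomial.monic_X_sub_C _
  have hDdeg : D.natDegree = 4 * (2 * n + 1) := by
    rw [hD, Polynomial.natDegree_prod_of_monic _ _ fun i _ => Polynomial.monic_X_sub_C _]
    simp only [Polynomial.natDegree_X_sub_C, Finset.sum_const, smul_eq_mul, mul_one]
    rw [ht, Finset.card_product, Finset.card_product, Finset.card_univ, Fintype.card_bool, hJ, Nat.card_Icc]
    omega
  obtain ⟨c', hc'⟩ := hdvd
  have hF0 : F ≠ 0 := hypSubst_sum_ne_zero hq hprim hP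
  have hp0 : p ≠ 0 := fun h => hF0 (rapUni_injective 1 (h.trans (map_zero _).symm))
  have hc'0 : c' ≠ 0 := by rintro rfl; rw [mul_zero] at hc'; exact hp0 hc'
  have hpdeg : p.natDegree ≤ 4 * (2 * n + 1) := (natDegree_rapUni_le 1 F).trans hdeg
  have hc'deg : c'.natDegree = 0 := by
    have := Polynomial.natDegree_mul hDmonic.ne_zero hc'0
    rw [← hc', hDdeg] at this
    omega
  -- `c'` is the constant leading coefficient of `p`, the image of an `X_1`-free polynomial
  obtain ⟨c, hc1, hclead⟩ := leadingCoeff_rapUni 1 F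
  have hc'eq : c' = Polynomial.C (toRF ℂ c) := by
    rw [Polynomial.eq_C_of_natDegree_eq_zero hc'deg]
    congr 1
    have h1 : p.leadingCoeff = c'.leadingCoeff := by rw [hc', Polynomial.leadingCoeff_monic_mul hDmonic]
    rw [Polynomial.leadingCoeff, Polynomial.leadingCoeff, hc'deg] at h1
    rw [← h1]
    have h2 := hclead
    rw [Polynomial.leadingCoeff] at h2
    exact h2
  refine ⟨c, hc1, ?_⟩
  -- evaluate at `z_1`
  have hev := congrArg (Polynomial.eval (genZ ℂ 1)) hc'
  rw [hp, eval_rapUni_genZ, Polynomial.eval_mul, hc'eq, Polynomial.eval_C, hD, Polynomial.eval_prod] at hev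
  rw [hev, mul_comm]
  congr 1
  rw [ht, Finset.prod_product]
  refine Finset.prod_congr rfl fun j _ => ?_
  simp only [Polynomial.eval_sub, Polynomial.eval_X, Polynomial.eval_C, hroot]
  exact prod_wheelRoot_bool q j (genZ ℂ 1)

end Pinning

end Literature.Probability.Percolation
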